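import Summits.HodgeConjecture.HodgeConjecture.Theorems.WeilTypeLadder
import Literature.AlgebraicGeometry.HodgeTheory.WeilClassesProductsOfFactors
import Literature.AlgebraicGeometry.HodgeTheory.WeilClassesFourfoldsDiscOneSchoen
import Literature.AlgebraicGeometry.HodgeTheory.WeilClassesSixfoldsSqrtMinus3Schoen
import Literature.AlgebraicGeometry.HodgeTheory.WeilClassesSixfoldsSqrtMinus1Koike
import HarnessLib

/-!
# WeilTypeLadder · product loci with ALL-CLASSICAL refereed trust bases (Schoen 1988, Schoen 1998, Koike 2004)

b2b cell `hweil` (packet `run/shared/lean/b2b/hodge-weil/`, CENSUS.md ## P3-g3), prover 3 gen 3. Companion of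
`Theorems/WeilTypeLadderProducts.lean`. The downward product step
(`Literature.AlgebraicGeometry.HodgeTheory.weilClassesOf_prod_le_algebraicClasses`, PROVED) is fed here with the
tree's REFEREED classical Weil-class facts instead of Markman's:

* `weilSixfolds_fourfoldProdSurface_of_schoen1988` — Schoen 1988 (Compositio 65; = van Geemen LNM 1594 Thm. 4.15;
  fact `Schoen1988_weilClasses_algebraic_hyperbolicFourfold_three_or_one`): Weil classes on hyperbolic FOURFOLDS with
  `K = ℚ(i)` or `ℚ(√-3)` ⟹ the body of R1/R1′ (`WeilSixfolds` / `NonsplitSixfolds`) on the SIXFOLD product loci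
  `X⁴ × S²`, `d ∈ {1, 3}`, `X` hyperbolic, `S` of type `(1,1)`. Trust base {Schoen 1988, Lefschetz (1,1)} — available since
  1988. With `S = S_D` a QM surface for a division algebra `D = (-d, b)_ℚ ∋ K` these sixfolds are of NON-split type
  (discriminant `-b`; census, not typed): the non-split `ℚ(√-3)`- and `ℚ(i)`-sixfold components contain 5-dimensional
  loci with algebraic Weil classes by 1988-vintage inputs.
* `splitEightfolds_sixfoldProdSurface_of_schoen1998` — Schoen 1998 (Compositio 114 §§11–13; fact
  `Schoen1998_weilClasses_algebraic_hyperbolicSixfold_three`: ALL hyperbolic `ℚ(√-3)`-sixfolds) ⟹ the R2₈/R∞(4) body on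
  the EIGHTFOLD loci `A⁶ × S²` (`d = 3`; 10-dimensional in the 16-dimensional moduli; discriminant `-δ_S`: split for
  `S ~ E²`, NON-split for `S = S_D`).
* `splitEightfolds_sixfoldProdSurface_of_koike2004` — the same at `d = 1` from Koike 2004 (fact
  `Koike2004_weilClasses_algebraic_hyperbolicSixfold_one`).
* `splitEightfolds_fourfoldProdFourfold_of_schoen1988` — eightfolds `X⁴ × Y⁴`, both factors hyperbolic, `d ∈ {1,3}`.

HONEST LABEL: instances on product loci (non-general members); conditional on refereed named facts; nothing about
discriminants is asserted in Lean; 0 unconditional rungs above the floor. No `sorry`, no new definition, no new fact.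
-/

noncomputable section

-- every declaration of this problem lives in `Summit.HodgeConjecture.HodgeConjecture.…` (summit = sub-problem)
set_option linter.dupNamespace false

open CategoryTheory
open Literature.AlgebraicGeometry Literature.AlgebraicGeometry.Motives
open Literature.AlgebraicGeometry.HodgeTheory
open Literature.AlgebraicTopology.SingularHomology

namespace Summit.HodgeConjecture.HodgeConjecture.WeilTypeLadder

variable {X Y B S : AbelianVariety ℂ}

/-- **R1/R1′ on `X⁴ × S²` from Schoen 1988 (`K = ℚ(i)` or `ℚ(√-3)`, `X` hyperbolic) — refereed since 1988.**
For `d ∈ {1, 3}`, a hyperbolic Weil fourfold `(X, φ)` (Schoen 1988 / van Geemen 4.15: its Weil classes are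
algebraic) and an abelian surface `(S, ψ)` of type `(1,1)` (Lefschetz), every rational `(3,3)`-class of the Weil plane
of `(X × S, φ × ψ)` is algebraic. [cite: Schoen1988HodgeWeil, Thm. 3.2 / vanGeemen1994HodgeAV Thm. 4.15]
[cite: Schoen1998HodgeWeilAddendum, §10] -/
theorem weilSixfolds_fourfoldProdSurface_of_schoen1988
    (hF : Schoen1988_weilClasses_algebraic_hyperbolicFourfold_three_or_one) {d : ℕ} (hd : d = 1 ∨ d = 3)
    (hX : X.dim = 2 * 2) (hS : S.dim = 2 * 1) {φ : X ⟶ X} {ψ : S ⟶ S}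
    (hφ : φ ≫ φ = -(d • 𝟙 X)) (hψ : ψ ≫ ψ = -(d • 𝟙 S)) (e : ProjectiveEmbedding X.X)
    {a : complexBetti (projectiveSpace e.n ℂ) 2} (ha : IsRationalClass a) (ha0 : a ≠ 0)
    (hhyp : IsHyperbolicWeilType X φ 2
      ((d : ℂ) • complexBetti.map e.ι 2 a + complexBetti.map φ.hom.hom.hom 2 (complexBetti.map e.ι 2 a)))
    (hSbal : Module.finrank ℂ ↥(Module.End.eigenspace (complexBetti.map ψ.hom.hom.hom 1).hom
          (Complex.I * (Real.sqrt d : ℂ)) ⊓ hodgeOneZero (Motives.isSmoothProjective_of_dim_eq' hS)) = 1) :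
    ∀ c : complexBetti (X.prod S).X (2 * 3), IsRationalClass c →
      IsOfHodgeType (2 * 3) (X.prod S).X (2 * 3) 3 3 c →
        c ∈ weilClassesOf (X.prod S)
          (AbelianVariety.prodLift (AbelianVariety.fst X S ≫ φ) (AbelianVariety.snd X S ≫ ψ)) 3 d →
          c ∈ algebraicClasses (X.prod S).X 3 := by
  have hd0 : 0 < d := by rcases hd with rfl | rfl <;> norm_num
  intro c _ _ hcW
  exact weilClassesOf_prod_le_algebraicClasses (n₁ := 2) (n₂ := 1) two_pos hd0 hX hS hφ hψ
    (weilClassesOf_le_algebraicClasses_of_isHyperbolicWeilType two_pos hd0 hX hφ e ha ha0 hhyp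
      (hF d hd X φ hX (Motives.isSmoothProjective_of_dim_eq' hX) hφ e a ha ha0 hhyp))
    (weilClassesOf_le_algebraicClasses_surface hS hd0 hψ hSbal) hcW

/-- **R2₈ / R∞(4) on `X⁴ × Y⁴` from Schoen 1988, both factors hyperbolic, `d ∈ {1, 3}`** (the product is a split
eightfold; refereed since 1988). [cite: Schoen1988HodgeWeil, Thm. 3.2 / vanGeemen1994HodgeAV Thm. 4.15]
[cite: Schoen1998HodgeWeilAddendum, §10] -/
theorem splitEightfolds_fourfoldProdFourfold_of_schoen1988
    (hF : Schoen1988_weilClasses_algebraic_hyperbolicFourfold_three_or_one) {d : ℕ} (hd : d = 1 ∨ d = 3)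
    (hX : X.dim = 2 * 2) (hY : Y.dim = 2 * 2) {φ : X ⟶ X} {χ : Y ⟶ Y}
    (hφ : φ ≫ φ = -(d • 𝟙 X)) (hχ : χ ≫ χ = -(d • 𝟙 Y)) (e : ProjectiveEmbedding X.X)
    {a : complexBetti (projectiveSpace e.n ℂ) 2} (ha : IsRationalClass a) (ha0 : a ≠ 0)
    (hhypX : IsHyperbolicWeilType X φ 2
      ((d : ℂ) • complexBetti.map e.ι 2 a + complexBetti.map φ.hom.hom.hom 2 (complexBetti.map e.ι 2 a)))
    (e' : ProjectiveEmbedding Y.X) {a' : complexBetti (projectiveSpace e'.n ℂ) 2}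
    (ha' : IsRationalClass a') (ha0' : a' ≠ 0)
    (hhypY : IsHyperbolicWeilType Y χ 2
      ((d : ℂ) • complexBetti.map e'.ι 2 a' + complexBetti.map χ.hom.hom.hom 2 (complexBetti.map e'.ι 2 a'))) :
    ∀ c : complexBetti (X.prod Y).X (2 * 4), IsRationalClass c →
      IsOfHodgeType (2 * 4) (X.prod Y).X (2 * 4) 4 4 c →
        c ∈ weilClassesOf (X.prod Y)
          (AbelianVariety.prodLift (AbelianVariety.fst X Y ≫ φ) (AbelianVariety.snd X Y ≫ χ)) 4 d →
          c ∈ algebraicClasses (X.prod Y).X 4 := by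
  have hd0 : 0 < d := by rcases hd with rfl | rfl <;> norm_num
  intro c _ _ hcW
  exact weilClassesOf_prod_le_algebraicClasses (n₁ := 2) (n₂ := 2) two_pos hd0 hX hY hφ hχ
    (weilClassesOf_le_algebraicClasses_of_isHyperbolicWeilType two_pos hd0 hX hφ e ha ha0 hhypX
      (hF d hd X φ hX (Motives.isSmoothProjective_of_dim_eq' hX) hφ e a ha ha0 hhypX))
    (weilClassesOf_le_algebraicClasses_of_isHyperbolicWeilType two_pos hd0 hY hχ e' ha' ha0' hhypY
      (hF d hd Y χ hY (Motives.isSmoothProjective_of_dim_eq' hY) hχ e' a' ha' ha0' hhypY)) hcW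

/-- **R2₈ / R∞(4) on the EIGHTFOLD loci `A⁶ × S²`, `K = ℚ(√-3)`, from Schoen 1998 (all hyperbolic `√-3`-sixfolds,
refereed) and Lefschetz.** For a hyperbolic `(A, φ)`, `φ² = -3`, `dim A = 6`, and a surface `(S, ψ)`, `ψ² = -3`, of
type `(1,1)`, every rational `(4,4)`-class of the Weil plane of `(A × S, φ × ψ)` is algebraic. Discriminant `-δ_S`
(census): split for `S ~ E²`, NON-split for `S` a QM surface by a division algebra `(-3, b)_ℚ ∋ ℚ(√-3)`.
[cite: Schoen1998HodgeWeilAddendum, §§10–13] [cite: vanGeemen1994HodgeAV, 7.3] -/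
theorem splitEightfolds_sixfoldProdSurface_of_schoen1998
    (hF : Schoen1998_weilClasses_algebraic_hyperbolicSixfold_three)
    (hB : B.dim = 2 * 3) (hS : S.dim = 2 * 1) {φ : B ⟶ B} {ψ : S ⟶ S}
    (hφ : φ ≫ φ = -((3 : ℕ) • 𝟙 B)) (hψ : ψ ≫ ψ = -((3 : ℕ) • 𝟙 S)) (e : ProjectiveEmbedding B.X)
    {a : complexBetti (projectiveSpace e.n ℂ) 2} (ha : IsRationalClass a) (ha0 : a ≠ 0)
    (hhyp : IsHyperbolicWeilType B φ 3
      (((3 : ℕ) : ℂ) • complexBetti.map e.ι 2 a + complexBetti.map φ.hom.hom.hom 2 (complexBetti.map e.ι 2 a)))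
    (hSbal : Module.finrank ℂ ↥(Module.End.eigenspace (complexBetti.map ψ.hom.hom.hom 1).hom
          (Complex.I * (Real.sqrt (3 : ℕ) : ℂ)) ⊓ hodgeOneZero (Motives.isSmoothProjective_of_dim_eq' hS)) = 1) :
    ∀ c : complexBetti (B.prod S).X (2 * 4), IsRationalClass c →
      IsOfHodgeType (2 * 4) (B.prod S).X (2 * 4) 4 4 c →
        c ∈ weilClassesOf (B.prod S)
          (AbelianVariety.prodLift (AbelianVariety.fst B S ≫ φ) (AbelianVariety.snd B S ≫ ψ)) 4 3 →
          c ∈ algebraicClasses (B.prod S).X 4 := by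
  intro c _ _ hcW
  exact weilClassesOf_prod_le_algebraicClasses (n₁ := 3) (n₂ := 1) (by norm_num) (by norm_num) hB hS hφ hψ
    (weilClassesOf_le_algebraicClasses_of_isHyperbolicWeilType (by norm_num) (by norm_num) hB hφ e ha ha0 hhyp
      (hF B φ hB (Motives.isSmoothProjective_of_dim_eq' hB) hφ e a ha ha0 hhyp))
    (weilClassesOf_le_algebraicClasses_surface hS (by norm_num) hψ hSbal) hcW

/-- **R2₈ / R∞(4) on the EIGHTFOLD loci `A⁶ × S²`, `K = ℚ(i)`, from Koike 2004 (all hyperbolic `ℚ(i)`-sixfolds,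
refereed) and Lefschetz.** As `splitEightfolds_sixfoldProdSurface_of_schoen1998` with `d = 1`.
[cite: Koike2004WeilHodge, Cor. 2.1] [cite: Schoen1998HodgeWeilAddendum, §10] -/
theorem splitEightfolds_sixfoldProdSurface_of_koike2004
    (hF : Koike2004_weilClasses_algebraic_hyperbolicSixfold_one)
    (hB : B.dim = 2 * 3) (hS : S.dim = 2 * 1) {φ : B ⟶ B} {ψ : S ⟶ S}
    (hφ : φ ≫ φ = -((1 : ℕ) • 𝟙 B)) (hψ : ψ ≫ ψ = -((1 : ℕ) • 𝟙 S)) (e : ProjectiveEmbedding B.X)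
    {a : complexBetti (projectiveSpace e.n ℂ) 2} (ha : IsRationalClass a) (ha0 : a ≠ 0)
    (hhyp : IsHyperbolicWeilType B φ 3
      (((1 : ℕ) : ℂ) • complexBetti.map e.ι 2 a + complexBetti.map φ.hom.hom.hom 2 (complexBetti.map e.ι 2 a)))
    (hSbal : Module.finrank ℂ ↥(Module.End.eigenspace (complexBetti.map ψ.hom.hom.hom 1).hom
          (Complex.I * (Real.sqrt (1 : ℕ) : ℂ)) ⊓ hodgeOneZero (Motives.isSmoothProjective_of_dim_eq' hS)) = 1) :
    ∀ c : complexBetti (B.prod S).X (2 * 4), IsRationalClass c →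
      IsOfHodgeType (2 * 4) (B.prod S).X (2 * 4) 4 4 c →
        c ∈ weilClassesOf (B.prod S)
          (AbelianVariety.prodLift (AbelianVariety.fst B S ≫ φ) (AbelianVariety.snd B S ≫ ψ)) 4 1 →
          c ∈ algebraicClasses (B.prod S).X 4 := by
  intro c _ _ hcW
  exact weilClassesOf_prod_le_algebraicClasses (n₁ := 3) (n₂ := 1) (by norm_num) (by norm_num) hB hS hφ hψ
    (weilClassesOf_le_algebraicClasses_of_isHyperbolicWeilType (by norm_num) (by norm_num) hB hφ e ha ha0 hhyp
      (hF B φ hB (Motives.isSmoothProjective_of_dim_eq' hB) hφ e a ha ha0 hhyp))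
    (weilClassesOf_le_algebraicClasses_surface hS (by norm_num) hψ hSbal) hcW

end Summit.HodgeConjecture.HodgeConjecture.WeilTypeLadder

end
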